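import Mathlib.RepresentationTheory.Irreducible
import Mathlib.RepresentationTheory.Semisimple
import Mathlib.LinearAlgebra.Projection
import HarnessLib

/-!
# A reducible semisimple representation has a non-scalar intertwining self-map
(crux stmt-Langlands-14329 `IrreducibilityBySelfDuality.IrreducibleOffSector`, line `Sketch`;
stub `exists_nonscalar_intertwiningMap_of_not_isIrreducible` (W4) of the base-change ascent
package, lead c7)

Let `ρ : G →* End_k(V)` be a representation of a group `G` on a non-zero `k`-vector space `V`
which is **semisimple** (every subrepresentation has a complementary subrepresentation) but **not
irreducible**.  Then the commutant `End_G(V)` is not reduced to the scalars: there is a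
`G`-equivariant `T : V →ₗ[k] V` with `T ≠ c • id` for every `c : k`.

This is the elementary half of Schur's lemma used in the Galois core of the base-change ascent
closure operator for the crux "cuspidal ⇒ irreducible" (Clifford's dichotomy for a normal subgroup
with cyclic quotient): the restriction `π|_N` of an irreducible `π` is semisimple, and if it were
reducible the projection onto a proper complemented `N`-subrepresentation would be a non-scalar
`N`-endomorphism, on which one diagonalises the conjugation action of `G/N`.

Proof.  Since `V ≠ 0`, `⊥ ≠ ⊤` in `Subrepresentation ρ`; as `ρ` is not irreducible there is a
subrepresentation `W` with `W ≠ ⊥`, `W ≠ ⊤`.  Pick a complement `W'` (semisimplicity); the lattice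
structure on subrepresentations is induced from submodules, so `W ⊕ W' = V` as submodules.  The
projection `P` onto `W` along `W'` is idempotent with range `W` and kernel `W'`, both `ρ g`-stable,
hence `P` commutes with every `ρ g` (`LinearMap.IsIdempotentElem.commute_iff`).  It is not a
scalar: `P w' = 0` for a non-zero `w' ∈ W'` forces `c = 0`, while `P w = w ≠ 0` for a non-zero
`w ∈ W`.
-/

noncomputable section

-- `Summit.Langlands.Langlands.…` (summit = sub-problem name, D-0017 layout) trips `dupNamespace`.
set_option linter.dupNamespace false

namespace Summit.Langlands.Langlands.Theorems.IrreducibleOffSector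

/-- If the underlying submodules of two subrepresentations `W`, `W'` of `ρ` are complementary,
the projection onto `W` along `W'` commutes with every `ρ g` (it is idempotent with `ρ g`-stable
range `W` and kernel `W'`). [folklore] -/
theorem projection_comp_eq_comp_projection {k : Type*} [Field k] {G : Type*} [Group G]
    {V : Type*} [AddCommGroup V] [Module k V] (ρ : Representation k G V)
    (W W' : Subrepresentation ρ) (hc : IsCompl W.toSubmodule W'.toSubmodule) (g : G) :
    W.toSubmodule.projection W'.toSubmodule hc ∘ₗ ρ g =
      ρ g ∘ₗ W.toSubmodule.projection W'.toSubmodule hc := by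
  refine ((LinearMap.IsIdempotentElem.commute_iff (T := ρ g)
    (Submodule.isIdempotentElem_projection hc)).2 ⟨?_, ?_⟩).eq
  · rw [Submodule.range_projection, Module.End.mem_invtSubmodule_iff_forall_mem_of_mem]
    exact fun x hx => W.apply_mem_toSubmodule g hx
  · rw [Submodule.ker_projection, Module.End.mem_invtSubmodule_iff_forall_mem_of_mem]
    exact fun x hx => W'.apply_mem_toSubmodule g hx

/-- Subrepresentations are complementary iff their underlying submodules are (the lattice
structure on `Subrepresentation ρ` is induced from `Submodule k V`). [folklore] -/
theorem isCompl_toSubmodule_of_isCompl {k : Type*} [Field k] {G : Type*} [Group G] {V : Type*}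
    [AddCommGroup V] [Module k V] {ρ : Representation k G V} {W W' : Subrepresentation ρ}
    (h : IsCompl W W') : IsCompl W.toSubmodule W'.toSubmodule := by
  constructor
  · rw [disjoint_iff]
    exact congrArg Subrepresentation.toSubmodule (disjoint_iff.mp h.disjoint)
  · rw [codisjoint_iff]
    exact congrArg Subrepresentation.toSubmodule (codisjoint_iff.mp h.codisjoint)

/-- **Reducible semisimple representations have non-scalar endomorphisms.**  If a representation
`ρ` of a group on a non-zero vector space is semisimple but not irreducible, then some
intertwining self-map of `ρ` is not a scalar multiple of the identity (namely the projection onto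
a proper non-zero complemented subrepresentation). [folklore] -/
theorem exists_nonscalar_intertwiningMap_of_not_isIrreducible {k : Type*} [Field k] {G : Type*}
    [Group G] {V : Type*} [AddCommGroup V] [Module k V] [Nontrivial V]
    (ρ : Representation k G V) (hss : ρ.IsSemisimpleRepresentation) (hirr : ¬ ρ.IsIrreducible) :
    ∃ T : ρ.IntertwiningMap ρ, ∀ c : k, T.toLinearMap ≠ c • LinearMap.id := by
  -- `⊥ ≠ ⊤` among subrepresentations, since `V ≠ 0`.
  have hbt : (⊥ : Subrepresentation ρ) ≠ ⊤ := fun h =>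
    bot_ne_top (congrArg Subrepresentation.toSubmodule h : (⊥ : Submodule k V) = ⊤)
  -- A proper non-zero subrepresentation `W`.
  obtain ⟨W, hWb, hWt⟩ : ∃ W : Subrepresentation ρ, W ≠ ⊥ ∧ W ≠ ⊤ := by
    by_contra h
    refine hirr { exists_pair_ne := ⟨⊥, ⊤, hbt⟩, eq_bot_or_eq_top := fun W => ?_ }
    by_contra hW
    exact h ⟨W, fun hb => hW (Or.inl hb), fun ht => hW (Or.inr ht)⟩
  -- A complement `W'`, non-zero since `W ≠ ⊤`.
  haveI := hss
  obtain ⟨W', hWW'⟩ := exists_isCompl W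
  have hc : IsCompl W.toSubmodule W'.toSubmodule := isCompl_toSubmodule_of_isCompl hWW'
  have hW'b : W' ≠ ⊥ := by
    rintro rfl
    exact hWt (eq_top_of_isCompl_bot hWW')
  have hWb' : W.toSubmodule ≠ ⊥ := fun h => hWb (Subrepresentation.toSubmodule_injective
    (show W.toSubmodule = (⊥ : Subrepresentation ρ).toSubmodule from h))
  have hW'b' : W'.toSubmodule ≠ ⊥ := fun h => hW'b (Subrepresentation.toSubmodule_injective
    (show W'.toSubmodule = (⊥ : Subrepresentation ρ).toSubmodule from h))
  obtain ⟨w, hw, hw0⟩ := Submodule.exists_mem_ne_zero_of_ne_bot hWb'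
  obtain ⟨w', hw', hw'0⟩ := Submodule.exists_mem_ne_zero_of_ne_bot hW'b'
  -- The projection onto `W` along `W'` is the sought intertwining map.
  refine ⟨⟨W.toSubmodule.projection W'.toSubmodule hc,
    projection_comp_eq_comp_projection ρ W W' hc⟩, fun c hcT => ?_⟩
  have hP : W.toSubmodule.projection W'.toSubmodule hc = c • LinearMap.id := hcT
  have h1 : W.toSubmodule.projection W'.toSubmodule hc w = c • w := by
    rw [hP, LinearMap.smul_apply, LinearMap.id_apply]
  have h2 : W.toSubmodule.projection W'.toSubmodule hc w' = c • w' := by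
    rw [hP, LinearMap.smul_apply, LinearMap.id_apply]
  rw [Submodule.projection_apply_of_mem_left hc hw] at h1
  rw [Submodule.projection_apply_of_mem_right hc hw'] at h2
  have hc0 : c = 0 := (smul_eq_zero.mp h2.symm).resolve_right hw'0
  rw [hc0, zero_smul] at h1
  exact hw0 h1

end Summit.Langlands.Langlands.Theorems.IrreducibleOffSector

end
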